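import Mathlib.Analysis.Calculus.BumpFunction.InnerProduct
import Mathlib.Analysis.SpecialFunctions.JapaneseBracket
import Mathlib.Analysis.PSeries
import Mathlib.Analysis.SpecialFunctions.Pow.Deriv
import Mathlib.Analysis.Complex.ExponentialBounds
import Literature.Analysis.Fourier.FractalUncertaintyPrincipleProofs
import HarnessLib

/-!
# The weight adapted to a regular set (Bourgain–Dyatlov 2018, proof of Lemma 3.1)

Topic `Literature/Analysis/Fourier`; companion to `FractalUncertaintyPrinciple.lean` (the named
fact `bourgainDyatlov2018_thm4`, BD18 Theorem 4) and `FractalUncertaintyPrincipleProofs.lean`.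
J. Bourgain, S. Dyatlov, *Spectral gaps without the pressure condition*, Ann. of Math. 187
(2018), §3.1 ("An adapted multiplier") proves Lemma 3.1 — a compactly supported `ψ` whose Fourier
transform decays like `exp(-c₂ θ(ξ)|ξ|)` on a `δ`-regular set `Y`, `θ(ξ) = log(10+|ξ|)^{-(1+δ)/2}`
— in two steps: (i) an explicit weight `ω ∈ C¹(ℝ; (0,1])` ADAPTED TO `Y` is built from small
covers of `Y ∩ (±[2^n, 2^{n+1}])` by intervals of size `ρ_n = n^{-(1+δ)/2} 2^n`
(`ω = exp(-2⟨ξ⟩^{1/2}) Π_n Π_{J ∈ 𝒥_n} exp(-10 χ_J)`), and shown to satisfy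
`sup|∂_ξ log ω| ≤ C₀`, `∫ |log ω(ξ)| (1+ξ²)⁻¹ dξ ≤ C₀` with `C₀ = C₀(δ, C_R)` INDEPENDENT of the
upper scale `α₁`, `ω ≤ exp(-⟨ξ⟩^{1/2})` on `ℝ` and `ω ≤ exp(-θ(ξ)|ξ|)` on `Y`; (ii) the
quantitative Beurling–Malliavin multiplier theorem (BD18 Lemma 2.11, from Theorem 5 there) is
applied to `ω`. This file PROVES step (i) completely (sorry-free, no definitions, no named facts),
together with the covering lemma it rests on:

* `card_cells_le_of_regularity_witness`, `IsRegularSet.card_cells_le` — **BD18 Lemma 2.8** ("the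
  small cover property"): the grid cells `[ρj, ρ(j+1)]` meeting `X ∩ [a, a+l]`,
  `α₀ ≤ ρ ≤ l ≤ α₁`, number at most `6 C_R² (l/ρ)^δ` (the paper prints `12 C_R²`); listed as
  "deliberately not here" in `RegularSets.lean`.
* `card_near_le` — the bounded-overlap count of the fattened cover intervals (paper: "each `ξ`
  lies in at most 500 intervals `J̃`"; here `≤ 51` with the explicit bookkeeping `≤ 3` per level,
  levels `n ≤ 15` or at most two levels `n ≥ 16`).
* `card_fibre_le` — `N_n ≤ 12 C_R² n^{δ(1+δ)/2}` (paper: `24 C_R² (2^n/ρ_n)^δ`).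
* `exists_adaptedLogWeight` — the weight in logarithmic form `Ω = -log ω ∈ C¹`:
  `Ω ≥ ⟨ξ⟩^{1/2}`, `sup |Ω'| ≤ C₀`, `∫ Ω(ξ)(1+ξ²)⁻¹ dξ ≤ C₀`, `Ω ≥ θ(ξ)|ξ|` on `Y`.
* `exists_adaptedWeight` — the same for `ω = exp(-Ω) ∈ C¹(ℝ; (0,1])`, i.e. exactly the input
  that the proof of Lemma 3.1 feeds to Lemma 2.11.

Rendering. `⟨ξ⟩^{1/2} = (1+ξ²)^{1/4}`; the cutoff `χ` of the paper (`C¹`, `0 ≤ χ ≤ 1`, `χ = 1` on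
`[-1/2, 1/2]`, `supp χ ⊂ [-1, 1]`, `|χ'| ≤ 10`) is Mathlib's smooth bump `ContDiffBump 0` with
radii `1/2 < 1`, whose derivative bound `B` enters `C₀` (the paper's `10⁵`); the cover at level
`n` is indexed by the pairs `(n, j)` of a finite set `T ⊂ ℕ × ℤ` (cell `[ρ_n j, ρ_n (j+1)]`
meeting `Y ∩ {2^n ≤ |x| ≤ 2^{n+1}}`, `1 ≤ n`, `2^n ≤ α₁`). The summability step is the paper's:
`Σ_n N_n ρ_n² 2^{-2n} ≲ C_R² Σ_n n^{-(1+δ)(1-δ/2)} < ∞` because `(1+δ)(1-δ/2) > 1` for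
`0 < δ < 1`.

Deliberately NOT here: the Beurling–Malliavin theorem (BD18 Theorem 5) and Lemma 2.11, hence the
function `ψ` of Lemma 3.1 itself; §2.4 / §3.2–§3.4 of BD18.
-/

namespace Literature.Analysis.Fourier

open _root_.MeasureTheory Set
open scoped ENNReal Topology

section SmallCover

variable {X : Set ℝ} {δ C_R α₀ α₁ : ℝ}

/-- **The small cover property** (BD18 Lemma 2.8), witness/counting form. Let `μ` satisfy the
two regularity inequalities of Definition 1.1 for `X` with exponent `δ ≥ 0` and constant `C_R ≥ 1`
on scales `α₀` to `α₁`, and let `α₀ ≤ ρ ≤ l ≤ α₁`, `ρ > 0`. Then any finite set `S` of grid cells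
`[ρj, ρ(j+1)]` each meeting `X ∩ [a, a + l]` has `#S ≤ 6 C_R² (l/ρ)^δ` (the paper prints `12 C_R²`):
the `ρ`-intervals centred at points of `X` in the cells have mass `≥ C_R⁻¹ρ^δ`, lie in
`[a - ρ/2, a + l + ρ/2]` (mass `≤ 2 C_R l^δ`), and overlap at most threefold.
[cite: BourgainDyatlov2018, Lemma 2.8] -/
theorem card_cells_le_of_regularity_witness (μ : Measure ℝ)
    (hμ : ∀ a b : ℝ, a < b → α₀ ≤ b - a → b - a ≤ α₁ →
        μ (Icc a b) ≤ ENNReal.ofReal (C_R * (b - a) ^ δ) ∧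
          ((a + b) / 2 ∈ X → ENNReal.ofReal (C_R⁻¹ * (b - a) ^ δ) ≤ μ (Icc a b)))
    (hC : 1 ≤ C_R) {ρ a l : ℝ} (hρ : 0 < ρ) (hρ₀ : α₀ ≤ ρ) (hρl : ρ ≤ l)
    (hl : l ≤ α₁) (S : Finset ℤ)
    (hS : ∀ j ∈ S, (X ∩ Icc a (a + l) ∩ Icc (ρ * j) (ρ * (j + 1))).Nonempty) :
    (S.card : ℝ) ≤ 6 * C_R ^ 2 * (l / ρ) ^ δ := by
  classical
  choose! c hc using hS
  have hC0 : 0 < C_R := one_pos.trans_le hC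
  have hl0 : 0 < l := hρ.trans_le hρl
  have hlδ : 0 ≤ l ^ δ := Real.rpow_nonneg hl0.le δ
  set E : Set ℝ := Icc (a - ρ / 2) (a + l + ρ / 2) with hE
  -- mass of `E`: two intervals of size `l`
  have hμE : μ E ≤ ENNReal.ofReal (2 * C_R * l ^ δ) := by
    have h1 := (hμ (a - ρ / 2) (a - ρ / 2 + l) (by linarith) (by linarith) (by linarith)).1
    have h2 := (hμ (a + ρ / 2) (a + l + ρ / 2) (by linarith) (by linarith) (by linarith)).1
    have hcov : E ⊆ Icc (a - ρ / 2) (a - ρ / 2 + l) ∪ Icc (a + ρ / 2) (a + l + ρ / 2) := by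
      intro x hx
      simp only [hE, mem_Icc] at hx
      by_cases hxa : x ≤ a - ρ / 2 + l
      · exact Or.inl ⟨hx.1, hxa⟩
      · exact Or.inr ⟨by linarith [lt_of_not_ge hxa], hx.2⟩
    calc μ E ≤ μ (Icc (a - ρ / 2) (a - ρ / 2 + l) ∪ Icc (a + ρ / 2) (a + l + ρ / 2)) :=
          measure_mono hcov
      _ ≤ μ (Icc (a - ρ / 2) (a - ρ / 2 + l)) + μ (Icc (a + ρ / 2) (a + l + ρ / 2)) :=
          measure_union_le _ _
      _ ≤ ENNReal.ofReal (C_R * l ^ δ) + ENNReal.ofReal (C_R * l ^ δ) := by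
          gcongr
          · simpa using h1
          · have : a + l + ρ / 2 - (a + ρ / 2) = l := by ring
            simpa [this] using h2
      _ = ENNReal.ofReal (2 * C_R * l ^ δ) := by
          rw [← ENNReal.ofReal_add (by positivity) (by positivity)]; ring_nf
  have key := card_mul_le_of_centred_intervals (μ := μ) (S := S) (c := c) (p := 0) (w := ρ)
    (m := C_R⁻¹ * ρ ^ δ) (B := 2 * C_R * l ^ δ) (E := E) hρ (by positivity)
    (fun j hj => by
      have h := (hc j hj).2
      simp only [mem_Icc] at h
      constructor <;> nlinarith [h.1, h.2])
    (fun j hj => by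
      have h := (hμ (c j - ρ / 2) (c j + ρ / 2) (by linarith) (by linarith) (by linarith)).2
      have hmid : (c j - ρ / 2 + (c j + ρ / 2)) / 2 = c j := by ring
      rw [hmid] at h
      have := h (hc j hj).1.1
      simpa using this)
    (fun j hj => by
      have h := (hc j hj).1.2
      simp only [mem_Icc] at h
      intro x hx
      simp only [mem_Icc, hE] at hx ⊢
      constructor <;> linarith [hx.1, hx.2, h.1, h.2])
    hμE
  -- `#S · C_R⁻¹ ρ^δ ≤ 6 C_R l^δ`
  have hρδ : 0 < ρ ^ δ := Real.rpow_pos_of_pos hρ δ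
  rw [Real.div_rpow hl0.le hρ.le, mul_div_assoc']
  rw [le_div_iff₀ hρδ]
  have : (S.card : ℝ) * ρ ^ δ = C_R * ((S.card : ℝ) * (C_R⁻¹ * ρ ^ δ)) := by
    field_simp
  rw [this]
  calc C_R * ((S.card : ℝ) * (C_R⁻¹ * ρ ^ δ)) ≤ C_R * (3 * (2 * C_R * l ^ δ)) := by gcongr
    _ = 6 * C_R ^ 2 * l ^ δ := by ring

/-- **The small cover property** (BD18 Lemma 2.8) for `IsRegularSet`: if `X` is `δ`-regular with
constant `C_R ≥ 1` on scales `α₀` to `α₁` and `0 < ρ`, `α₀ ≤ ρ ≤ l ≤ α₁`, then the grid cells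
`[ρj, ρ(j+1)]` meeting `X ∩ [a, a+l]` — which form a nonoverlapping cover of `X ∩ [a, a+l]` by
intervals of size `ρ` — are at most `6 C_R² (l/ρ)^δ` in number (paper: `12 C_R²`).
[cite: BourgainDyatlov2018, Lemma 2.8] -/
theorem IsRegularSet.card_cells_le (h : IsRegularSet X δ C_R α₀ α₁) (hC : 1 ≤ C_R) {ρ a l : ℝ}
    (hρ : 0 < ρ) (hρ₀ : α₀ ≤ ρ) (hρl : ρ ≤ l) (hl : l ≤ α₁) (S : Finset ℤ)
    (hS : ∀ j ∈ S, (X ∩ Icc a (a + l) ∩ Icc (ρ * j) (ρ * (j + 1))).Nonempty) :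
    (S.card : ℝ) ≤ 6 * C_R ^ 2 * (l / ρ) ^ δ := by
  obtain ⟨-, -, μ, -, hμ⟩ := h
  exact card_cells_le_of_regularity_witness μ hμ hC hρ hρ₀ hρl hl S hS

end SmallCover

namespace AdaptedWeight

section Bracket

/-! ### The term `2⟨ξ⟩^{1/2} = 2(1+ξ²)^{1/4}` -/

/-- `1 + ξ² > 0`. [folklore] -/
theorem one_add_sq_pos (ξ : ℝ) : 0 < 1 + ξ ^ 2 := by positivity

/-- `ξ ↦ (1+ξ²)^{1/4}` is smooth. [folklore] -/
theorem contDiff_bracket {n : WithTop ℕ∞} : ContDiff ℝ n fun ξ : ℝ => (1 + ξ ^ 2) ^ (1 / 4 : ℝ) :=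
  (contDiff_const.add (contDiff_id.pow 2)).rpow_const_of_ne fun ξ => (one_add_sq_pos ξ).ne'

/-- Derivative of `(1+ξ²)^{1/4}`. [folklore] -/
theorem hasDerivAt_bracket (ξ : ℝ) :
    HasDerivAt (fun ξ : ℝ => (1 + ξ ^ 2) ^ (1 / 4 : ℝ))
      (2 * ξ * (1 / 4) * (1 + ξ ^ 2) ^ (1 / 4 - 1 : ℝ)) ξ := by
  have h1 : HasDerivAt (fun ξ : ℝ => 1 + ξ ^ 2) (2 * ξ) ξ := by
    simpa using ((hasDerivAt_pow 2 ξ).const_add 1)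
  exact h1.rpow_const (Or.inl (one_add_sq_pos ξ).ne')

/-- `|∂_ξ (1+ξ²)^{1/4}| ≤ 1/2`. [folklore] -/
theorem abs_deriv_bracket_le (ξ : ℝ) :
    |2 * ξ * (1 / 4) * (1 + ξ ^ 2) ^ (1 / 4 - 1 : ℝ)| ≤ 1 / 2 := by
  have hpos := one_add_sq_pos ξ
  have h1 : |ξ| ≤ (1 + ξ ^ 2) ^ (3 / 4 : ℝ) := by
    calc |ξ| = Real.sqrt (ξ ^ 2) := (Real.sqrt_sq_eq_abs ξ).symm
      _ ≤ Real.sqrt (1 + ξ ^ 2) := Real.sqrt_le_sqrt (by linarith)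
      _ = (1 + ξ ^ 2) ^ (1 / 2 : ℝ) := Real.sqrt_eq_rpow _
      _ ≤ (1 + ξ ^ 2) ^ (3 / 4 : ℝ) :=
          Real.rpow_le_rpow_of_exponent_le (by nlinarith) (by norm_num)
  have h34 : (0 : ℝ) < (1 + ξ ^ 2) ^ (3 / 4 : ℝ) := Real.rpow_pos_of_pos hpos _
  have h2 : (1 + ξ ^ 2) ^ (1 / 4 - 1 : ℝ) = ((1 + ξ ^ 2) ^ (3 / 4 : ℝ))⁻¹ := by
    rw [← Real.rpow_neg hpos.le]; norm_num
  rw [h2, abs_mul, abs_mul, abs_mul, abs_inv, abs_of_pos h34, abs_of_pos (by norm_num : (0:ℝ) < 1 / 4),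
    abs_two]
  rw [show 2 * |ξ| * (1 / 4) * ((1 + ξ ^ 2) ^ (3 / 4 : ℝ))⁻¹ = (|ξ| / (1 + ξ ^ 2) ^ (3 / 4 : ℝ)) / 2 by
    ring]
  have : |ξ| / (1 + ξ ^ 2) ^ (3 / 4 : ℝ) ≤ 1 := (div_le_one h34).2 h1
  linarith

/-- `1 ≤ (1+ξ²)^{1/4}`. [folklore] -/
theorem one_le_bracket (ξ : ℝ) : 1 ≤ (1 + ξ ^ 2) ^ (1 / 4 : ℝ) :=
  Real.one_le_rpow (by nlinarith) (by norm_num)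

/-- `(1+ξ²)^{1/4}/(1+ξ²) = (1+ξ²)^{-3/4}`. [folklore] -/
theorem bracket_div_eq (ξ : ℝ) :
    (1 + ξ ^ 2) ^ (1 / 4 : ℝ) / (1 + ξ ^ 2) = (1 + ξ ^ 2) ^ (-(3 / 2 : ℝ) / 2) := by
  have hpos := one_add_sq_pos ξ
  rw [div_eq_mul_inv, ← Real.rpow_neg_one, ← Real.rpow_add hpos]
  norm_num

/-- `ξ ↦ (1+ξ²)^{-3/4}` is integrable on `ℝ`. [folklore] -/
theorem integrable_bracket_div :
    Integrable fun ξ : ℝ => (1 + ξ ^ 2) ^ (1 / 4 : ℝ) / (1 + ξ ^ 2) := by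
  have h := integrable_rpow_neg_one_add_norm_sq (E := ℝ) (μ := volume) (r := 3 / 2)
    (by rw [Module.finrank_self]; norm_num)
  refine (h.congr ?_)
  filter_upwards with ξ
  rw [bracket_div_eq, Real.norm_eq_abs, sq_abs]

end Bracket

section BumpTerms

/-! ### Scaled cutoffs `χ_J(ξ) = |J| χ((ξ - ξ_J)/|J|)` -/

variable {χ : ℝ → ℝ}

/-- Derivative of a scaled cutoff: `∂_ξ (r χ((ξ-c)/r)) = χ'((ξ-c)/r)`. [folklore] -/
theorem hasDerivAt_scaledCutoff (hχ : Differentiable ℝ χ) {r : ℝ} (hr : r ≠ 0) (c ξ : ℝ) :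
    HasDerivAt (fun ξ => r * χ ((ξ - c) / r)) (deriv χ ((ξ - c) / r)) ξ := by
  have h1 : HasDerivAt (fun ξ => (ξ - c) / r) (1 / r) ξ := by
    simpa using ((hasDerivAt_id ξ).sub_const c).div_const r
  have h2 : HasDerivAt (fun ξ => χ ((ξ - c) / r)) (deriv χ ((ξ - c) / r) * (1 / r)) ξ :=
    (hχ _).hasDerivAt.comp ξ h1
  have h3 := h2.const_mul r
  have e : r * (deriv χ ((ξ - c) / r) * (1 / r)) = deriv χ ((ξ - c) / r) := by
    field_simp
  rwa [e] at h3

/-- A `C¹` cutoff vanishing for `|y| ≥ 1` has derivative vanishing for `|y| > 1`. [folklore] -/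
theorem deriv_eq_zero_of_one_lt_abs (hχ0 : ∀ y, 1 ≤ |y| → χ y = 0) {y : ℝ} (hy : 1 < |y|) :
    deriv χ y = 0 := by
  have h : χ =ᶠ[𝓝 y] fun _ => 0 := by
    have ho : IsOpen {z : ℝ | 1 < |z|} := isOpen_lt continuous_const continuous_abs
    filter_upwards [ho.mem_nhds hy] with z hz
    exact hχ0 z (le_of_lt hz)
  rw [h.deriv_eq]
  simp

/-- If `χ'((ξ-c)/r) ≠ 0` (`r > 0`, `χ = 0` off `(-1,1)`) then `|ξ - c| ≤ r`. [folklore] -/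
theorem abs_sub_le_of_deriv_ne_zero (hχ0 : ∀ y, 1 ≤ |y| → χ y = 0) {r : ℝ} (hr : 0 < r) {c ξ : ℝ}
    (h : deriv χ ((ξ - c) / r) ≠ 0) : |ξ - c| ≤ r := by
  by_contra hlt
  have hlt' : 1 < |(ξ - c) / r| := by
    rw [abs_div, abs_of_pos hr, lt_div_iff₀ hr, one_mul]
    exact lt_of_not_ge hlt
  exact h (deriv_eq_zero_of_one_lt_abs hχ0 hlt')

/-- If `|ξ - c| > r` then `χ((ξ-c)/r) = 0`. [folklore] -/
theorem scaledCutoff_eq_zero (hχ0 : ∀ y, 1 ≤ |y| → χ y = 0) {r : ℝ} (hr : 0 < r) {c ξ : ℝ}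
    (h : r < |ξ - c|) : χ ((ξ - c) / r) = 0 := by
  apply hχ0
  rw [abs_div, abs_of_pos hr, le_div_iff₀ hr, one_mul]
  exact h.le

/-- If `|ξ - c| ≤ r/2` then `r χ((ξ-c)/r) = r`. [folklore] -/
theorem scaledCutoff_eq_self (hχ1 : ∀ y, |y| ≤ 1 / 2 → χ y = 1) {r : ℝ} (hr : 0 < r) {c ξ : ℝ}
    (h : |ξ - c| ≤ r / 2) : r * χ ((ξ - c) / r) = r := by
  rw [hχ1 _ ?_, mul_one]
  rw [abs_div, abs_of_pos hr, div_le_iff₀ hr]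
  linarith

variable {ι : Type*}

/-- Derivative of a finite sum of scaled cutoffs. [folklore] -/
theorem hasDerivAt_sum_scaledCutoff (hχ : Differentiable ℝ χ) (T : Finset ι) (c r : ι → ℝ)
    (hr : ∀ i ∈ T, r i ≠ 0) (ξ : ℝ) :
    HasDerivAt (fun ξ => ∑ i ∈ T, r i * χ ((ξ - c i) / r i))
      (∑ i ∈ T, deriv χ ((ξ - c i) / r i)) ξ :=
  HasDerivAt.fun_sum fun i hi => hasDerivAt_scaledCutoff hχ (hr i hi) (c i) ξ

/-- The derivative of a sum of scaled cutoffs is bounded by `sup|χ'|` times the number of the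
fattened intervals `[c_i - r_i, c_i + r_i]` containing the point (BD18 §3.1: "each `ξ` lies in at
most 500 intervals `J̃`"). [cite: BourgainDyatlov2018, §3.1] -/
theorem abs_sum_deriv_scaledCutoff_le [DecidableEq ι] (hχ0 : ∀ y, 1 ≤ |y| → χ y = 0) {B : ℝ}
    (hB : ∀ y, |deriv χ y| ≤ B) (T : Finset ι) (c r : ι → ℝ) (hr : ∀ i ∈ T, 0 < r i) (ξ : ℝ) :
    |∑ i ∈ T, deriv χ ((ξ - c i) / r i)| ≤
      B * ((T.filter fun i => |ξ - c i| ≤ r i).card : ℝ) := by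
  have hB0 : 0 ≤ B := (abs_nonneg _).trans (hB 0)
  rw [← Finset.sum_filter_of_ne (p := fun i => |ξ - c i| ≤ r i)
    (fun i hi hne => abs_sub_le_of_deriv_ne_zero hχ0 (hr i hi) hne)]
  calc |∑ i ∈ T.filter (fun i => |ξ - c i| ≤ r i), deriv χ ((ξ - c i) / r i)|
      ≤ ∑ i ∈ T.filter (fun i => |ξ - c i| ≤ r i), |deriv χ ((ξ - c i) / r i)| :=
        Finset.abs_sum_le_sum_abs _ _
    _ ≤ ∑ _i ∈ T.filter (fun i => |ξ - c i| ≤ r i), B := Finset.sum_le_sum fun i _ => hB _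
    _ = B * ((T.filter fun i => |ξ - c i| ≤ r i).card : ℝ) := by
        rw [Finset.sum_const, nsmul_eq_mul, mul_comm]

/-- Pointwise bounds `0 ≤ r χ((ξ-c)/r) ≤ r` for `0 ≤ χ ≤ 1`, `r > 0`. [folklore] -/
theorem scaledCutoff_nonneg (hχ : ∀ y, 0 ≤ χ y) {r : ℝ} (hr : 0 < r) (c ξ : ℝ) :
    0 ≤ r * χ ((ξ - c) / r) := mul_nonneg hr.le (hχ _)

/-- `r χ((ξ-c)/r) ≤ r` for `χ ≤ 1`, `r > 0`. [folklore] -/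
theorem scaledCutoff_le (hχ : ∀ y, χ y ≤ 1) {r : ℝ} (hr : 0 < r) (c ξ : ℝ) :
    r * χ ((ξ - c) / r) ≤ r := by
  have := mul_le_mul_of_nonneg_left (hχ ((ξ - c) / r)) hr.le
  simpa using this

/-- **Poisson integral of one scaled cutoff**: if `1/(1+ξ²) ≤ w` on `[c - r, c + r]` then
`∫ r χ((ξ-c)/r)/(1+ξ²) dξ ≤ 2 r² w` (and the integrand is integrable). [folklore] -/
theorem integral_scaledCutoff_div_le (hχc : Continuous χ) (hχ : ∀ y, 0 ≤ χ y) (hχ' : ∀ y, χ y ≤ 1)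
    (hχ0 : ∀ y, 1 ≤ |y| → χ y = 0) {r : ℝ} (hr : 0 < r) (c : ℝ) {w : ℝ} (hw : 0 ≤ w)
    (hwξ : ∀ ξ, |ξ - c| ≤ r → 1 / (1 + ξ ^ 2) ≤ w) :
    Integrable (fun ξ => r * χ ((ξ - c) / r) / (1 + ξ ^ 2)) ∧
      ∫ ξ, r * χ ((ξ - c) / r) / (1 + ξ ^ 2) ≤ 2 * r ^ 2 * w := by
  set g : ℝ → ℝ := fun ξ => r * χ ((ξ - c) / r) / (1 + ξ ^ 2) with hg
  set I : Set ℝ := Icc (c - r) (c + r) with hI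
  have hdom : ∀ ξ, g ξ ≤ I.indicator (fun _ => r * w) ξ := by
    intro ξ
    by_cases hξ : |ξ - c| ≤ r
    · have hmem : ξ ∈ I := by
        rw [abs_le] at hξ
        exact ⟨by linarith [hξ.1], by linarith [hξ.2]⟩
      rw [indicator_of_mem hmem]
      calc g ξ = r * χ ((ξ - c) / r) * (1 / (1 + ξ ^ 2)) := by simp only [hg]; ring
        _ ≤ r * w := by
            apply mul_le_mul (scaledCutoff_le hχ' hr c ξ) (hwξ ξ hξ) (by positivity) hr.le
    · have h0 : χ ((ξ - c) / r) = 0 := scaledCutoff_eq_zero hχ0 hr (lt_of_not_ge hξ)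
      simp only [hg, h0, mul_zero, zero_div]
      exact indicator_nonneg (fun _ _ => by positivity) ξ
  have hnn : ∀ ξ, 0 ≤ g ξ := fun ξ => by
    simp only [hg]; exact div_nonneg (scaledCutoff_nonneg hχ hr c ξ) (one_add_sq_pos ξ).le
  have hgc : Continuous g := by
    simp only [hg]
    refine Continuous.div (continuous_const.mul (hχc.comp ?_)) (by fun_prop)
      fun ξ => (one_add_sq_pos ξ).ne'
    fun_prop
  have hind : Integrable (I.indicator fun _ => r * w) :=
    (integrable_indicator_iff measurableSet_Icc).2 (integrableOn_const (by
      rw [Real.volume_Icc]; exact ENNReal.ofReal_ne_top))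
  have hgi : Integrable g :=
    hind.mono' hgc.aestronglyMeasurable (Filter.Eventually.of_forall fun ξ => by
      rw [Real.norm_eq_abs, abs_of_nonneg (hnn ξ)]; exact hdom ξ)
  refine ⟨hgi, ?_⟩
  calc ∫ ξ, g ξ ≤ ∫ ξ, I.indicator (fun _ => r * w) ξ := integral_mono hgi hind hdom
    _ = 2 * r ^ 2 * w := by
        rw [integral_indicator measurableSet_Icc, setIntegral_const, smul_eq_mul,
          Real.volume_real_Icc_of_le (by linarith)]
        ring

end BumpTerms

section Scales

/-! ### The scales `ρ_n = n^{-(1+δ)/2} 2^n` of BD18 §3.1 -/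

variable {δ : ℝ}

/-- `2n ≤ 2^n` for `n ≥ 1`. [folklore] -/
theorem two_mul_le_two_pow (n : ℕ) (hn : 1 ≤ n) : (2 : ℝ) * n ≤ 2 ^ n := by
  obtain ⟨m, rfl⟩ : ∃ m, n = m + 1 := ⟨n - 1, by omega⟩
  have h : m < 2 ^ m := Nat.lt_two_pow_self
  have h' : (m : ℝ) + 1 ≤ 2 ^ m := by exact_mod_cast h
  push_cast
  rw [pow_succ]
  nlinarith

/-- `ρ_n ≥ 2` for `n ≥ 1` (`0 ≤ δ ≤ 1`). [cite: BourgainDyatlov2018, §3.1] -/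
theorem two_le_scale (hδ1 : δ ≤ 1) {n : ℕ} (hn : 1 ≤ n) :
    2 ≤ (n : ℝ) ^ (-(1 + δ) / 2) * 2 ^ n := by
  have hn1 : (1 : ℝ) ≤ n := by exact_mod_cast hn
  have hn0 : (0 : ℝ) < n := by positivity
  have h1 : (n : ℝ)⁻¹ ≤ (n : ℝ) ^ (-(1 + δ) / 2) := by
    rw [← Real.rpow_neg_one]
    exact Real.rpow_le_rpow_of_exponent_le hn1 (by linarith)
  have h2 := two_mul_le_two_pow n hn
  calc (2 : ℝ) = (n : ℝ)⁻¹ * (2 * n) := by field_simp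
    _ ≤ (n : ℝ) ^ (-(1 + δ) / 2) * 2 ^ n :=
        mul_le_mul h1 h2 (by positivity) (Real.rpow_nonneg hn0.le _)

/-- `ρ_n > 0` for `n ≥ 1`. [cite: BourgainDyatlov2018, §3.1] -/
theorem scale_pos (hδ1 : δ ≤ 1) {n : ℕ} (hn : 1 ≤ n) : 0 < (n : ℝ) ^ (-(1 + δ) / 2) * 2 ^ n :=
  two_pos.trans_le (two_le_scale hδ1 hn)

/-- `ρ_n ≤ 2^n` (`δ ≥ -1`, `n ≥ 1`). [cite: BourgainDyatlov2018, §3.1] -/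
theorem scale_le_two_pow (hδ0 : 0 ≤ δ) {n : ℕ} (hn : 1 ≤ n) :
    (n : ℝ) ^ (-(1 + δ) / 2) * 2 ^ n ≤ 2 ^ n := by
  have hn1 : (1 : ℝ) ≤ n := by exact_mod_cast hn
  have h : (n : ℝ) ^ (-(1 + δ) / 2) ≤ 1 := Real.rpow_le_one_of_one_le_of_nonpos hn1 (by linarith)
  have h2 : (0 : ℝ) ≤ 2 ^ n := by positivity
  nlinarith

/-- `ρ_n ≤ 2^n/4` for `n ≥ 16` (`δ ≥ 0`). [cite: BourgainDyatlov2018, §3.1] -/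
theorem scale_le_two_pow_div_four (hδ0 : 0 ≤ δ) {n : ℕ} (hn : 16 ≤ n) :
    (n : ℝ) ^ (-(1 + δ) / 2) * 2 ^ n ≤ 2 ^ n / 4 := by
  have hn1 : (16 : ℝ) ≤ n := by exact_mod_cast hn
  have h1 : (n : ℝ) ^ (-(1 + δ) / 2) ≤ (n : ℝ) ^ (-(1 / 2) : ℝ) :=
    Real.rpow_le_rpow_of_exponent_le (by linarith) (by linarith)
  have h2 : (n : ℝ) ^ (-(1 / 2) : ℝ) ≤ (16 : ℝ) ^ (-(1 / 2) : ℝ) :=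
    Real.rpow_le_rpow_of_nonpos (by norm_num) hn1 (by norm_num)
  have h3 : (16 : ℝ) ^ (-(1 / 2) : ℝ) = 1 / 4 := by
    rw [Real.rpow_neg (by norm_num), ← Real.sqrt_eq_rpow, show (16 : ℝ) = 4 ^ 2 by norm_num,
      Real.sqrt_sq (by norm_num)]
    norm_num
  have h4 : (0 : ℝ) ≤ 2 ^ n := by positivity
  calc (n : ℝ) ^ (-(1 + δ) / 2) * 2 ^ n ≤ (1 / 4) * 2 ^ n := by
        apply mul_le_mul_of_nonneg_right _ h4; linarith
    _ = 2 ^ n / 4 := by ring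

/-- `ρ_n² = n^{-(1+δ)} 4^n` (`n ≥ 1`). [cite: BourgainDyatlov2018, §3.1] -/
theorem scale_sq {n : ℕ} (hn : 1 ≤ n) :
    ((n : ℝ) ^ (-(1 + δ) / 2) * 2 ^ n) ^ 2 = (n : ℝ) ^ (-(1 + δ)) * 4 ^ n := by
  have hn0 : (0 : ℝ) < n := by exact_mod_cast hn
  rw [mul_pow, sq, ← Real.rpow_add hn0, ← pow_mul, show -(1 + δ) / 2 + -(1 + δ) / 2 = -(1 + δ) by ring]
  congr 1
  rw [mul_comm, pow_mul]; norm_num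

/-- `(2^n/ρ_n)^δ = n^{δ(1+δ)/2}` (`n ≥ 1`). [cite: BourgainDyatlov2018, §3.1] -/
theorem two_pow_div_scale_rpow {n : ℕ} (hn : 1 ≤ n) :
    ((2 : ℝ) ^ n / ((n : ℝ) ^ (-(1 + δ) / 2) * 2 ^ n)) ^ δ = (n : ℝ) ^ (δ * (1 + δ) / 2) := by
  have hn0 : (0 : ℝ) < n := by exact_mod_cast hn
  have h2 : (0 : ℝ) < 2 ^ n := by positivity
  have e : (2 : ℝ) ^ n / ((n : ℝ) ^ (-(1 + δ) / 2) * 2 ^ n) = (n : ℝ) ^ ((1 + δ) / 2) := by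
    rw [show -(1 + δ) / 2 = -((1 + δ) / 2) by ring, Real.rpow_neg hn0.le]
    field_simp
  rw [e, ← Real.rpow_mul hn0.le]
  ring_nf

end Scales

section Family

/-! ### Bounded overlap of the fattened cover intervals

Abstract form: `T ⊂ ℕ × ℤ` indexes cells `[ρ_n j, ρ_n (j+1)]` (`(n, j) ∈ T`) each meeting the
annulus `A_n = {2^n ≤ |x| ≤ 2^{n+1}}`, with `n ≥ 1`, scales `ρ_n > 0`, `ρ_n ≤ 2^n/4` for `n ≥ 16`. -/

variable {ρ : ℕ → ℝ} {T : Finset (ℕ × ℤ)}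

/-- If `n ≥ 16`, the cell `(n, j)` meets `A_n` and `ξ` is within `ρ_n` of its centre, then
`(5/8) 2^n ≤ |ξ| ≤ (19/8) 2^n`. [cite: BourgainDyatlov2018, §3.1] -/
theorem abs_bounds_of_near (hρ16 : ∀ n : ℕ, 16 ≤ n → ρ n ≤ 2 ^ n / 4) {n : ℕ} (hn : 16 ≤ n)
    {j : ℤ} {x ξ : ℝ} (hxA : (2 : ℝ) ^ n ≤ |x| ∧ |x| ≤ 2 ^ (n + 1))
    (hxc : ρ n * j ≤ x ∧ x ≤ ρ n * (j + 1)) (hξ : |ξ - ρ n * (j + 1 / 2)| ≤ ρ n) :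
    5 / 8 * (2 : ℝ) ^ n ≤ |ξ| ∧ |ξ| ≤ 19 / 8 * (2 : ℝ) ^ n := by
  have hρ := hρ16 n hn
  have h1 : |x - ρ n * (j + 1 / 2)| ≤ ρ n / 2 := by
    rw [abs_le]; constructor <;> nlinarith [hxc.1, hxc.2]
  have h2 : |ξ - x| ≤ 3 / 8 * 2 ^ n := by
    calc |ξ - x| = |(ξ - ρ n * (j + 1 / 2)) - (x - ρ n * (j + 1 / 2))| := by ring_nf
      _ ≤ |ξ - ρ n * (j + 1 / 2)| + |x - ρ n * (j + 1 / 2)| := abs_sub _ _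
      _ ≤ ρ n + ρ n / 2 := add_le_add hξ h1
      _ ≤ 3 / 8 * 2 ^ n := by linarith
  have h3 : |x| - |ξ| ≤ |ξ - x| := by
    rw [abs_sub_comm]; exact abs_sub_abs_le_abs_sub x ξ
  have h4 : |ξ| - |x| ≤ |ξ - x| := abs_sub_abs_le_abs_sub ξ x
  constructor
  · linarith [hxA.1]
  · have : (2 : ℝ) ^ (n + 1) = 2 * 2 ^ n := by ring
    linarith [hxA.2]

/-- At most two indices `n ≥ 16` can have a cell whose `ρ_n`-fattening contains a given `ξ`:
any two of them differ by at most one. [cite: BourgainDyatlov2018, §3.1] -/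
theorem card_filter_sixteen_le_two (W : Finset ℕ) {ξ : ℝ}
    (hW : ∀ n ∈ W, 16 ≤ n ∧ 5 / 8 * (2 : ℝ) ^ n ≤ |ξ| ∧ |ξ| ≤ 19 / 8 * (2 : ℝ) ^ n) :
    W.card ≤ 2 := by
  classical
  have hpair : ∀ n ∈ W, ∀ m ∈ W, m ≤ n + 1 := by
    intro n hn m hm
    by_contra hlt
    have hle : n + 2 ≤ m := by omega
    have hpow : (2 : ℝ) ^ (n + 2) ≤ 2 ^ m := pow_le_pow_right₀ (by norm_num) hle
    have e : (2 : ℝ) ^ (n + 2) = 4 * 2 ^ n := by ring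
    have h0 : (0 : ℝ) < 2 ^ n := by positivity
    linarith [(hW n hn).2.2, (hW m hm).2.1]
  by_cases hWe : W = ∅
  · simp [hWe]
  · have hne : W.Nonempty := Finset.nonempty_iff_ne_empty.2 hWe
    set w₀ := W.min' hne
    have hsub : W ⊆ {w₀, w₀ + 1} := by
      intro m hm
      have h1 : w₀ ≤ m := Finset.min'_le W m hm
      have h2 : m ≤ w₀ + 1 := hpair w₀ (Finset.min'_mem W hne) m hm
      simp only [Finset.mem_insert, Finset.mem_singleton]
      omega
    exact (Finset.card_le_card hsub).trans Finset.card_le_two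

/-- For fixed `n`, at most three cells `(n, j)` have `ρ_n`-fattenings containing `ξ`.
[cite: BourgainDyatlov2018, §3.1] -/
theorem card_fibre_near_le_three (hρ : ∀ p ∈ T, 0 < ρ p.1) (ξ : ℝ) (n : ℕ) :
    ((T.filter fun p => |ξ - ρ p.1 * (p.2 + 1 / 2)| ≤ ρ p.1).filter (fun p => p.1 = n)).card ≤ 3 := by
  classical
  set F := (T.filter fun p => |ξ - ρ p.1 * (p.2 + 1 / 2)| ≤ ρ p.1).filter (fun p => p.1 = n)
  by_cases hF : F = ∅
  · simp [hF]
  obtain ⟨p₀, hp₀⟩ := Finset.nonempty_iff_ne_empty.2 hF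
  have hρn : 0 < ρ n := by
    simp only [F, Finset.mem_filter] at hp₀
    rw [← hp₀.2]; exact hρ p₀ hp₀.1.1
  set u := ξ / ρ n
  have hmaps : Set.MapsTo (Prod.snd : ℕ × ℤ → ℤ) (F : Set (ℕ × ℤ))
      (Finset.Icc ⌈u - 3 / 2⌉ ⌊u + 1 / 2⌋ : Finset ℤ) := by
    intro p hp
    simp only [Finset.coe_filter, Set.mem_setOf_eq, F, Finset.mem_filter] at hp
    obtain ⟨⟨-, hnear⟩, hpn⟩ := hp
    rw [hpn] at hnear
    rw [abs_le] at hnear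
    simp only [Finset.coe_Icc, Set.mem_Icc]
    have hu : u * ρ n = ξ := by simp only [u]; field_simp
    constructor
    · apply Int.ceil_le.2
      have : (u - 3 / 2) * ρ n ≤ (p.2 : ℝ) * ρ n := by nlinarith [hnear.2]
      exact le_of_mul_le_mul_right this hρn
    · apply Int.le_floor.2
      have : (p.2 : ℝ) * ρ n ≤ (u + 1 / 2) * ρ n := by nlinarith [hnear.1]
      exact le_of_mul_le_mul_right this hρn
  have hinj : Set.InjOn (Prod.snd : ℕ × ℤ → ℤ) (F : Set (ℕ × ℤ)) := by
    intro p hp q hq hpq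
    simp only [Finset.coe_filter, Set.mem_setOf_eq, F, Finset.mem_filter] at hp hq
    exact Prod.ext (hp.2.trans hq.2.symm) hpq
  have hcard := Finset.card_le_card_of_injOn Prod.snd hmaps hinj
  refine hcard.trans ?_
  rw [Int.card_Icc]
  have h1 : (⌊u + 1 / 2⌋ : ℝ) ≤ u + 1 / 2 := Int.floor_le _
  have h2 : u - 3 / 2 ≤ (⌈u - 3 / 2⌉ : ℝ) := Int.le_ceil _
  have h3 : (⌊u + 1 / 2⌋ : ℝ) + 1 - ⌈u - 3 / 2⌉ ≤ 3 := by linarith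
  have h4 : ⌊u + 1 / 2⌋ + 1 - ⌈u - 3 / 2⌉ ≤ (3 : ℤ) := by exact_mod_cast h3
  omega

/-- **Bounded overlap** (BD18 §3.1, "each `ξ` lies in at most 500 intervals `J̃`"): the number of
cells `(n, j) ∈ T` whose `ρ_n`-fattening `[ρ_n(j+1/2) - ρ_n, ρ_n(j+1/2) + ρ_n]` contains `ξ` is at
most `51` (at most `3` per index `n`; indices `n ≤ 15` or one of at most two `n ≥ 16`).
[cite: BourgainDyatlov2018, §3.1] -/
theorem card_near_le (hρ16 : ∀ n : ℕ, 16 ≤ n → ρ n ≤ 2 ^ n / 4) (hρ : ∀ p ∈ T, 0 < ρ p.1)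
    (hT1 : ∀ p ∈ T, 1 ≤ p.1)
    (hTmeet : ∀ p ∈ T, ∃ x : ℝ, ((2 : ℝ) ^ p.1 ≤ |x| ∧ |x| ≤ 2 ^ (p.1 + 1)) ∧
      (ρ p.1 * p.2 ≤ x ∧ x ≤ ρ p.1 * (p.2 + 1)))
    (ξ : ℝ) :
    (T.filter fun p => |ξ - ρ p.1 * (p.2 + 1 / 2)| ≤ ρ p.1).card ≤ 51 := by
  classical
  set P := T.filter fun p => |ξ - ρ p.1 * (p.2 + 1 / 2)| ≤ ρ p.1
  set Ns := P.image Prod.fst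
  have hcardP : P.card = ∑ n ∈ Ns, (P.filter fun p => p.1 = n).card :=
    Finset.card_eq_sum_card_image Prod.fst P
  have hfib : ∀ n ∈ Ns, (P.filter fun p => p.1 = n).card ≤ 3 := fun n _ =>
    card_fibre_near_le_three hρ ξ n
  have hP3 : P.card ≤ 3 * Ns.card := by
    rw [hcardP]
    calc ∑ n ∈ Ns, (P.filter fun p => p.1 = n).card ≤ ∑ _n ∈ Ns, 3 := Finset.sum_le_sum hfib
      _ = 3 * Ns.card := by rw [Finset.sum_const, smul_eq_mul, mul_comm]
  set W := Ns.filter fun n => 16 ≤ n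
  have hW : ∀ n ∈ W, 16 ≤ n ∧ 5 / 8 * (2 : ℝ) ^ n ≤ |ξ| ∧ |ξ| ≤ 19 / 8 * (2 : ℝ) ^ n := by
    intro n hn
    simp only [W, Ns, P, Finset.mem_filter, Finset.mem_image, Prod.exists, exists_and_right,
      exists_eq_right] at hn
    obtain ⟨⟨j, hjT, hnear⟩, hn16⟩ := hn
    obtain ⟨x, hxA, hxc⟩ := hTmeet _ hjT
    exact ⟨hn16, abs_bounds_of_near hρ16 hn16 hxA hxc hnear⟩
  have hWcard : W.card ≤ 2 := card_filter_sixteen_le_two W hW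
  have hNs : Ns ⊆ Finset.Icc 1 15 ∪ W := by
    intro n hn
    have hn1 : 1 ≤ n := by
      simp only [Ns, P, Finset.mem_image, Finset.mem_filter] at hn
      obtain ⟨p, ⟨hpT, -⟩, rfl⟩ := hn
      exact hT1 p hpT
    by_cases h15 : n ≤ 15
    · exact Finset.mem_union_left _ (Finset.mem_Icc.2 ⟨hn1, h15⟩)
    · exact Finset.mem_union_right _ (Finset.mem_filter.2 ⟨hn, by omega⟩)
  have hNscard : Ns.card ≤ 17 := by
    calc Ns.card ≤ (Finset.Icc 1 15 ∪ W).card := Finset.card_le_card hNs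
      _ ≤ (Finset.Icc 1 15).card + W.card := Finset.card_union_le _ _
      _ ≤ 15 + 2 := by rw [Nat.card_Icc]; omega
  omega

/-- **Poisson weight on a fattened cell**: if `(n, j) ∈ T` and `ξ` lies in the `ρ_n`-fattening of
the cell then `1/(1+ξ²) ≤ 4^{16}/4^n` (trivial for `n ≤ 15`; for `n ≥ 16`, `|ξ| ≥ (5/8)2^n`).
[cite: BourgainDyatlov2018, §3.1] -/
theorem inv_one_add_sq_le (hρ16 : ∀ n : ℕ, 16 ≤ n → ρ n ≤ 2 ^ n / 4) {n : ℕ} {j : ℤ} {x ξ : ℝ}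
    (hxA : (2 : ℝ) ^ n ≤ |x| ∧ |x| ≤ 2 ^ (n + 1)) (hxc : ρ n * j ≤ x ∧ x ≤ ρ n * (j + 1))
    (hξ : |ξ - ρ n * (j + 1 / 2)| ≤ ρ n) :
    1 / (1 + ξ ^ 2) ≤ (4 : ℝ) ^ 16 / 4 ^ n := by
  have hpos : (0 : ℝ) < 1 + ξ ^ 2 := by positivity
  have h4n : (0 : ℝ) < 4 ^ n := by positivity
  by_cases hn : 16 ≤ n
  · obtain ⟨hlo, -⟩ := abs_bounds_of_near hρ16 hn hxA hxc hξ
    have hsq : (5 / 8 * (2 : ℝ) ^ n) ^ 2 ≤ ξ ^ 2 := by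
      rw [← sq_abs ξ]; exact pow_le_pow_left₀ (by positivity) hlo 2
    have e : (5 / 8 * (2 : ℝ) ^ n) ^ 2 = 25 / 64 * 4 ^ n := by
      rw [mul_pow, ← pow_mul, mul_comm n 2, pow_mul]; norm_num
    rw [div_le_div_iff₀ hpos h4n, one_mul]
    have : (4 : ℝ) ^ 16 ≥ 64 / 25 := by norm_num
    nlinarith
  · have hle : (4 : ℝ) ^ n ≤ 4 ^ 16 := pow_le_pow_right₀ (by norm_num) (by omega)
    calc 1 / (1 + ξ ^ 2) ≤ 1 := by
          rw [div_le_one hpos]; nlinarith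
      _ ≤ (4 : ℝ) ^ 16 / 4 ^ n := by rw [le_div_iff₀ h4n, one_mul]; exact hle

end Family

section Construction

/-! ### The cover family of BD18 §3.1 and the adapted weight -/

variable {δ C_R α₁ : ℝ} {Y : Set ℝ}

/-- **Counting the cover at level `n`** (BD18 §3.1: `N_n ≤ 24 C_R² (2^n/ρ_n)^δ`; here `12 C_R²`):
if every `(n, j) ∈ T` has `n ≥ 1`, `2^n ≤ α₁` and its cell `[ρ_n j, ρ_n(j+1)]` meeting
`Y ∩ {2^n ≤ |x| ≤ 2^{n+1}}`, where `Y` is `δ`-regular with constant `C_R` on scales `2` to `α₁`,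
then `T` has at most `12 C_R² n^{δ(1+δ)/2}` elements with first coordinate `n` (small cover
property on `[2^n, 2^{n+1}]` and on `[-2^{n+1}, -2^n]`). [cite: BourgainDyatlov2018, §3.1] -/
theorem card_fibre_le (hY : IsRegularSet Y δ C_R 2 α₁) (hC : 1 ≤ C_R) (hδ0 : 0 ≤ δ) (hδ1 : δ ≤ 1)
    (T : Finset (ℕ × ℤ))
    (hT : ∀ p ∈ T, 1 ≤ p.1 ∧ (2 : ℝ) ^ p.1 ≤ α₁ ∧
      (Y ∩ {x | (2 : ℝ) ^ p.1 ≤ |x| ∧ |x| ≤ 2 ^ (p.1 + 1)} ∩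
        Icc ((p.1 : ℝ) ^ (-(1 + δ) / 2) * 2 ^ p.1 * p.2)
          ((p.1 : ℝ) ^ (-(1 + δ) / 2) * 2 ^ p.1 * (p.2 + 1))).Nonempty)
    (n : ℕ) :
    ((T.filter fun p => p.1 = n).card : ℝ) ≤ 12 * C_R ^ 2 * (n : ℝ) ^ (δ * (1 + δ) / 2) := by
  classical
  set F := T.filter fun p => p.1 = n
  by_cases hF : F = ∅
  · rw [hF, Finset.card_empty, Nat.cast_zero]; positivity
  obtain ⟨p₀, hp₀⟩ := Finset.nonempty_iff_ne_empty.2 hF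
  have hp₀' := Finset.mem_filter.1 hp₀
  have hn1 : 1 ≤ n := hp₀'.2 ▸ (hT p₀ hp₀'.1).1
  have hnα : (2 : ℝ) ^ n ≤ α₁ := hp₀'.2 ▸ (hT p₀ hp₀'.1).2.1
  set r : ℝ := (n : ℝ) ^ (-(1 + δ) / 2) * 2 ^ n with hrdef
  have hr0 : 0 < r := scale_pos hδ1 hn1
  have h2r : 2 ≤ r := two_le_scale hδ1 hn1
  have hrle : r ≤ 2 ^ n := scale_le_two_pow hδ0 hn1
  set J := F.image Prod.snd
  have hinj : Set.InjOn (Prod.snd : ℕ × ℤ → ℤ) (F : Set (ℕ × ℤ)) := by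
    intro p hp q hq hpq
    have hp' := (Finset.mem_filter.1 (Finset.mem_coe.1 hp)).2
    have hq' := (Finset.mem_filter.1 (Finset.mem_coe.1 hq)).2
    exact Prod.ext (hp'.trans hq'.symm) hpq
  have hFJ : F.card = J.card := (Finset.card_image_of_injOn hinj).symm
  set Jp := J.filter fun j : ℤ =>
    (Y ∩ Icc ((2 : ℝ) ^ n) ((2 : ℝ) ^ n + 2 ^ n) ∩ Icc (r * j) (r * (j + 1))).Nonempty
  set Jm := J.filter fun j : ℤ =>
    (Y ∩ Icc (-(2 : ℝ) ^ (n + 1)) (-(2 : ℝ) ^ (n + 1) + 2 ^ n) ∩ Icc (r * j) (r * (j + 1))).Nonempty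
  have hJsub : J ⊆ Jp ∪ Jm := by
    intro j hj
    obtain ⟨p, hpF, hpj⟩ := Finset.mem_image.1 hj
    have hp := Finset.mem_filter.1 hpF
    obtain ⟨x, ⟨hxY, hxA⟩, hxc⟩ := (hT p hp.1).2.2
    rw [hp.2] at hxA hxc
    rw [hpj] at hxc
    simp only [Set.mem_setOf_eq] at hxA
    rw [Finset.mem_union]
    by_cases hx0 : 0 ≤ x
    · left
      refine Finset.mem_filter.2 ⟨hj, x, ⟨hxY, ?_⟩, hxc⟩
      rw [abs_of_nonneg hx0] at hxA
      exact ⟨hxA.1, by rw [← two_mul, ← pow_succ']; exact hxA.2⟩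
    · right
      refine Finset.mem_filter.2 ⟨hj, x, ⟨hxY, ?_⟩, hxc⟩
      rw [abs_of_neg (lt_of_not_ge hx0)] at hxA
      constructor
      · linarith [hxA.2]
      · have : (2 : ℝ) ^ (n + 1) = 2 ^ n + 2 ^ n := by ring
        linarith [hxA.1]
  have hJp : (Jp.card : ℝ) ≤ 6 * C_R ^ 2 * ((2 : ℝ) ^ n / r) ^ δ :=
    hY.card_cells_le hC hr0 h2r hrle hnα Jp fun j hj => (Finset.mem_filter.1 hj).2
  have hJm : (Jm.card : ℝ) ≤ 6 * C_R ^ 2 * ((2 : ℝ) ^ n / r) ^ δ :=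
    hY.card_cells_le hC hr0 h2r hrle hnα Jm fun j hj => (Finset.mem_filter.1 hj).2
  have hcard : F.card ≤ Jp.card + Jm.card :=
    hFJ ▸ (Finset.card_le_card hJsub).trans (Finset.card_union_le _ _)
  have hcard' : (F.card : ℝ) ≤ Jp.card + Jm.card := by exact_mod_cast hcard
  rw [← two_pow_div_scale_rpow (δ := δ) hn1]
  linarith

/-- The index bounds: a cell `(n, j)` with `n ≥ 1`, `2^n ≤ α₁ ≤ K` meeting `{2^n ≤ |x| ≤ 2^{n+1}}`
has `n ≤ K` and `|j| ≤ 2^K + 1` (finiteness of the cover family). [folklore] -/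
theorem index_bounds (hδ1 : δ ≤ 1) {K : ℕ} (hK : α₁ ≤ K) {n : ℕ} {j : ℤ}
    (hn : 1 ≤ n) (hnα : (2 : ℝ) ^ n ≤ α₁) {x : ℝ} (hxA : (2 : ℝ) ^ n ≤ |x| ∧ |x| ≤ 2 ^ (n + 1))
    (hxc : (n : ℝ) ^ (-(1 + δ) / 2) * 2 ^ n * j ≤ x ∧ x ≤ (n : ℝ) ^ (-(1 + δ) / 2) * 2 ^ n * (j + 1)) :
    n ∈ Finset.Icc 1 K ∧ j ∈ Finset.Icc (-((2 ^ K + 1 : ℕ) : ℤ)) ((2 ^ K + 1 : ℕ) : ℤ) := by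
  set r : ℝ := (n : ℝ) ^ (-(1 + δ) / 2) * 2 ^ n with hrdef
  have hr0 : 0 < r := scale_pos hδ1 hn
  have h2r : 2 ≤ r := two_le_scale hδ1 hn
  have hnK : n ≤ K := by
    have h1 : (n : ℝ) < 2 ^ n := by exact_mod_cast (Nat.lt_two_pow_self : n < 2 ^ n)
    have h2 : (n : ℝ) < K := by linarith
    exact_mod_cast h2.le
  have hKpow : (2 : ℝ) ^ n ≤ 2 ^ K := pow_le_pow_right₀ (by norm_num) hnK
  have hxle : x ≤ 2 * 2 ^ n := by
    have := le_abs_self x; rw [pow_succ] at hxA; linarith [hxA.2]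
  have hxge : -(2 * 2 ^ n) ≤ x := by
    have := neg_abs_le x; rw [pow_succ] at hxA; linarith [hxA.2]
  have hj1 : (j : ℝ) ≤ 2 ^ n := by
    have h : r * j ≤ r * 2 ^ n := by nlinarith [hxc.1]
    exact le_of_mul_le_mul_left h hr0
  have hj2 : -(2 : ℝ) ^ n - 1 ≤ j := by
    have h : r * (-(2 : ℝ) ^ n) ≤ r * (j + 1) := by nlinarith [hxc.2]
    have := le_of_mul_le_mul_left h hr0
    linarith
  refine ⟨Finset.mem_Icc.2 ⟨hn, hnK⟩, Finset.mem_Icc.2 ⟨?_, ?_⟩⟩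
  · have h : (-((2 ^ K + 1 : ℕ) : ℝ)) ≤ j := by push_cast; linarith
    exact_mod_cast h
  · have h : (j : ℝ) ≤ ((2 ^ K + 1 : ℕ) : ℝ) := by push_cast; linarith
    exact_mod_cast h

/-- The decay rate `θ(ξ)|ξ|`, `θ(ξ) = log(10+|ξ|)^{-(1+δ)/2}`, is at most `2` for `|ξ| ≤ 2`
(proof of BD18 Lemma 3.1: "`exp(-2⟨ξ⟩^{1/2}) ≤ exp(-θ(ξ)|ξ|)` for `|ξ| ≤ 2`").
[cite: BourgainDyatlov2018, §3.1] -/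
theorem theta_mul_abs_le_two (hδ : -1 ≤ δ) {ξ : ℝ} (hξ : |ξ| ≤ 2) :
    Real.log (10 + |ξ|) ^ (-(1 + δ) / 2) * |ξ| ≤ 2 := by
  have hlog : 1 ≤ Real.log (10 + |ξ|) := by
    rw [Real.le_log_iff_exp_le (by positivity)]
    have := Real.exp_one_lt_d9
    linarith [abs_nonneg ξ]
  have hθ : Real.log (10 + |ξ|) ^ (-(1 + δ) / 2) ≤ 1 :=
    Real.rpow_le_one_of_one_le_of_nonpos hlog (by linarith)
  have hθ0 : 0 ≤ Real.log (10 + |ξ|) ^ (-(1 + δ) / 2) := Real.rpow_nonneg (by linarith) _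
  nlinarith [abs_nonneg ξ]

/-- The decay rate on the annulus: if `1 ≤ n`, `2^n ≤ |ξ| ≤ 2^{n+1}` and `δ ≤ 1` then
`θ(ξ)|ξ| ≤ 10 ρ_n` (indeed `≤ 2.9 ρ_n`; uses `log(10+|ξ|) ≥ n log 2` and `1/log 2 < 1.45`).
[cite: BourgainDyatlov2018, §3.1] -/
theorem theta_mul_abs_le_scale (hδ0 : 0 ≤ δ) (hδ1 : δ ≤ 1) {n : ℕ} (hn : 1 ≤ n) {ξ : ℝ}
    (h1 : (2 : ℝ) ^ n ≤ |ξ|) (h2 : |ξ| ≤ 2 ^ (n + 1)) :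
    Real.log (10 + |ξ|) ^ (-(1 + δ) / 2) * |ξ| ≤ 10 * ((n : ℝ) ^ (-(1 + δ) / 2) * 2 ^ n) := by
  have hn0 : (0 : ℝ) < n := by exact_mod_cast hn
  have hlog2 : (0.6931471803 : ℝ) < Real.log 2 := Real.log_two_gt_d9
  have hlog2' : Real.log 2 < 1 := by
    have := Real.log_two_lt_d9; linarith
  have hl2pos : 0 < Real.log 2 := by linarith
  have hnl : 0 < (n : ℝ) * Real.log 2 := mul_pos hn0 hl2pos
  -- `log(10 + |ξ|) ≥ log 2^n = n log 2`
  have hlog : (n : ℝ) * Real.log 2 ≤ Real.log (10 + |ξ|) := by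
    rw [← Real.log_pow]
    exact Real.log_le_log (by positivity) (by linarith)
  have hexp : -(1 + δ) / 2 ≤ 0 := by linarith
  have hθ1 : Real.log (10 + |ξ|) ^ (-(1 + δ) / 2) ≤ ((n : ℝ) * Real.log 2) ^ (-(1 + δ) / 2) :=
    Real.rpow_le_rpow_of_nonpos hnl hlog hexp
  have hθ2 : ((n : ℝ) * Real.log 2) ^ (-(1 + δ) / 2) =
      (n : ℝ) ^ (-(1 + δ) / 2) * Real.log 2 ^ (-(1 + δ) / 2) :=
    Real.mul_rpow hn0.le hl2pos.le
  have hθ3 : Real.log 2 ^ (-(1 + δ) / 2) ≤ Real.log 2 ^ (-1 : ℝ) :=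
    Real.rpow_le_rpow_of_exponent_ge hl2pos hlog2'.le (by linarith)
  have hθ4 : Real.log 2 ^ (-1 : ℝ) ≤ 1.45 := by
    rw [Real.rpow_neg_one]
    rw [inv_le_comm₀ hl2pos (by norm_num)]
    linarith
  have hnn : 0 ≤ (n : ℝ) ^ (-(1 + δ) / 2) := Real.rpow_nonneg hn0.le _
  have h2n : (0 : ℝ) ≤ 2 ^ n := by positivity
  calc Real.log (10 + |ξ|) ^ (-(1 + δ) / 2) * |ξ|
      ≤ ((n : ℝ) ^ (-(1 + δ) / 2) * 1.45) * (2 ^ (n + 1)) := by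
        apply mul_le_mul _ h2 (abs_nonneg ξ) (by positivity)
        calc Real.log (10 + |ξ|) ^ (-(1 + δ) / 2) ≤ (n : ℝ) ^ (-(1 + δ) / 2) * Real.log 2 ^ (-(1 + δ) / 2) :=
              hθ2 ▸ hθ1
          _ ≤ (n : ℝ) ^ (-(1 + δ) / 2) * 1.45 := by
              apply mul_le_mul_of_nonneg_left (hθ3.trans hθ4) hnn
    _ = 2.9 * ((n : ℝ) ^ (-(1 + δ) / 2) * 2 ^ n) := by ring
    _ ≤ 10 * ((n : ℝ) ^ (-(1 + δ) / 2) * 2 ^ n) := by nlinarith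

end Construction

end AdaptedWeight

section Main

variable {δ C_R : ℝ}

open AdaptedWeight in
/-- **The adapted weight of BD18 Lemma 3.1, logarithmic form.** Let `0 < δ < 1` and `C_R ≥ 1`.
There is `C₀ = C₀(δ, C_R) > 0` such that for every `α₁` and every `Y ⊂ [-α₁, α₁]` which is
`δ`-regular with constant `C_R` on scales `2` to `α₁` there is `Ω ∈ C¹(ℝ)` (the function
`-log ω` for the weight `ω` defined in the proof of BD18 Lemma 3.1:
`Ω(ξ) = 2⟨ξ⟩^{1/2} + 10 Σ_n Σ_{J ∈ 𝒥_n} χ_J(ξ)`) with `Ω ≥ ⟨ξ⟩^{1/2} := (1+ξ²)^{1/4}`,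
`sup |Ω'| ≤ C₀`, `∫ Ω(ξ)/(1+ξ²) dξ ≤ C₀`, and `Ω(ξ) ≥ θ(ξ)|ξ|` for all `ξ ∈ Y`,
`θ(ξ) = log(10+|ξ|)^{-(1+δ)/2}` — the constant being independent of `α₁`. This is the content of
the proof of BD18 Lemma 3.1 up to (but not including) the application of the quantitative
Beurling–Malliavin lemma (BD18 Lemma 2.11). [cite: BourgainDyatlov2018, §3.1, proof of Lemma 3.1] -/
theorem exists_adaptedLogWeight (hδ0 : 0 < δ) (hδ1 : δ < 1) (hC : 1 ≤ C_R) :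
    ∃ C₀ : ℝ, 0 < C₀ ∧ ∀ (α₁ : ℝ) (Y : Set ℝ), Y ⊆ Icc (-α₁) α₁ → IsRegularSet Y δ C_R 2 α₁ →
      ∃ Ω : ℝ → ℝ, ContDiff ℝ 1 Ω ∧
        (∀ ξ, (1 + ξ ^ 2) ^ (1 / 4 : ℝ) ≤ Ω ξ) ∧
        (∀ ξ, |deriv Ω ξ| ≤ C₀) ∧
        Integrable (fun ξ => Ω ξ / (1 + ξ ^ 2)) ∧
        (∫ ξ, Ω ξ / (1 + ξ ^ 2) ≤ C₀) ∧
        (∀ ξ ∈ Y, Real.log (10 + |ξ|) ^ (-(1 + δ) / 2) * |ξ| ≤ Ω ξ) := by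
  classical
  -- the fixed cutoff `χ`: a smooth bump, `= 1` on `[-1/2, 1/2]`, `= 0` off `(-1, 1)`
  let χb : ContDiffBump (0 : ℝ) := ⟨1 / 2, 1, by norm_num, by norm_num⟩
  set χ : ℝ → ℝ := fun y => χb y with hχdef
  have hχC : ContDiff ℝ 1 χ := χb.contDiff
  have hχd : Differentiable ℝ χ := hχC.differentiable one_ne_zero
  have hχc : Continuous χ := hχC.continuous
  have hχ0 : ∀ y, 0 ≤ χ y := fun y => χb.nonneg
  have hχ1 : ∀ y, χ y ≤ 1 := fun y => χb.le_one
  have hχone : ∀ y, |y| ≤ 1 / 2 → χ y = 1 := fun y hy =>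
    χb.one_of_mem_closedBall (Metric.mem_closedBall.2 (by
      show dist y 0 ≤ 1 / 2
      simpa [Real.dist_eq] using hy))
  have hχzero : ∀ y, 1 ≤ |y| → χ y = 0 := fun y hy =>
    χb.zero_of_le_dist (by
      show (1 : ℝ) ≤ dist y 0
      simpa [Real.dist_eq] using hy)
  obtain ⟨B, hB⟩ : ∃ B, ∀ y, |deriv χ y| ≤ B := by
    obtain ⟨B, hB⟩ := (χb.hasCompactSupport.deriv).exists_bound_of_continuous
      (hχC.continuous_deriv le_rfl)
    exact ⟨B, fun y => by simpa [Real.norm_eq_abs] using hB y⟩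
  have hB0 : 0 ≤ B := (abs_nonneg _).trans (hB 0)
  -- the constants
  set A₀ : ℝ := ∫ ξ : ℝ, (1 + ξ ^ 2) ^ (1 / 4 : ℝ) / (1 + ξ ^ 2) with hA₀
  have hA₀0 : 0 ≤ A₀ := integral_nonneg fun ξ => by
    have := one_le_bracket ξ; have := one_add_sq_pos ξ; positivity
  set s : ℝ := (1 + δ) * (2 - δ) / 2 with hs
  have hs1 : 1 < s := by simp only [hs]; nlinarith
  have hsum : Summable fun n : ℕ => (n : ℝ) ^ (-s) := Real.summable_nat_rpow.2 (by linarith)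
  set S : ℝ := ∑' n : ℕ, (n : ℝ) ^ (-s) with hS
  have hS0 : 0 ≤ S := tsum_nonneg fun n => Real.rpow_nonneg (Nat.cast_nonneg n) _
  set Kd : ℝ := 1 + 10 * (B * 51) with hKd
  set Ci : ℝ := 2 * A₀ + 10 * (24 * 4 ^ 16 * C_R ^ 2 * S) with hCi
  have hKd0 : 0 ≤ Kd := by positivity
  have hCi0 : 0 ≤ Ci := by positivity
  refine ⟨Kd + Ci + 1, by positivity, fun α₁ Y hYsub hY => ?_⟩
  -- the family of cells
  set K : ℕ := ⌈α₁⌉₊ with hKdef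
  have hK : α₁ ≤ K := Nat.le_ceil α₁
  set M : ℕ := 2 ^ K + 1 with hMdef
  set r : ℕ → ℝ := fun n => (n : ℝ) ^ (-(1 + δ) / 2) * 2 ^ n with hrdef
  set T : Finset (ℕ × ℤ) := ((Finset.Icc 1 K) ×ˢ (Finset.Icc (-(M : ℤ)) (M : ℤ))).filter
    (fun p => (2 : ℝ) ^ p.1 ≤ α₁ ∧ (Y ∩ {x | (2 : ℝ) ^ p.1 ≤ |x| ∧ |x| ≤ 2 ^ (p.1 + 1)} ∩
      Icc (r p.1 * p.2) (r p.1 * (p.2 + 1))).Nonempty) with hTdef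
  have hTmem : ∀ p : ℕ × ℤ, p ∈ T ↔ (p.1 ∈ Finset.Icc 1 K ∧ p.2 ∈ Finset.Icc (-(M : ℤ)) (M : ℤ)) ∧
      (2 : ℝ) ^ p.1 ≤ α₁ ∧ (Y ∩ {x | (2 : ℝ) ^ p.1 ≤ |x| ∧ |x| ≤ 2 ^ (p.1 + 1)} ∩
        Icc (r p.1 * p.2) (r p.1 * (p.2 + 1))).Nonempty := by
    intro p; simp only [hTdef, Finset.mem_filter, Finset.mem_product]
  have hT1 : ∀ p ∈ T, 1 ≤ p.1 := fun p hp => (Finset.mem_Icc.1 ((hTmem p).1 hp).1.1).1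
  have hT : ∀ p ∈ T, 1 ≤ p.1 ∧ (2 : ℝ) ^ p.1 ≤ α₁ ∧
      (Y ∩ {x | (2 : ℝ) ^ p.1 ≤ |x| ∧ |x| ≤ 2 ^ (p.1 + 1)} ∩
        Icc ((p.1 : ℝ) ^ (-(1 + δ) / 2) * 2 ^ p.1 * p.2)
          ((p.1 : ℝ) ^ (-(1 + δ) / 2) * 2 ^ p.1 * (p.2 + 1))).Nonempty := fun p hp =>
    ⟨hT1 p hp, ((hTmem p).1 hp).2.1, ((hTmem p).1 hp).2.2⟩
  have hTmeet : ∀ p ∈ T, ∃ x : ℝ, ((2 : ℝ) ^ p.1 ≤ |x| ∧ |x| ≤ 2 ^ (p.1 + 1)) ∧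
      (r p.1 * p.2 ≤ x ∧ x ≤ r p.1 * (p.2 + 1)) := by
    intro p hp
    obtain ⟨x, ⟨-, hxA⟩, hxc⟩ := ((hTmem p).1 hp).2.2
    exact ⟨x, hxA, hxc⟩
  have hrpos : ∀ p ∈ T, 0 < r p.1 := fun p hp => scale_pos hδ1.le (hT1 p hp)
  have hrne : ∀ p ∈ T, r p.1 ≠ 0 := fun p hp => (hrpos p hp).ne'
  have hr16 : ∀ n : ℕ, 16 ≤ n → r n ≤ 2 ^ n / 4 := fun n hn => scale_le_two_pow_div_four hδ0.le hn
  -- completeness of the family: every cell meeting `Y ∩ A_n`, `1 ≤ n`, `2^n ≤ α₁`, is in `T`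
  have hTcomplete : ∀ (n : ℕ) (j : ℤ), 1 ≤ n → (2 : ℝ) ^ n ≤ α₁ → ∀ x ∈ Y,
      (2 : ℝ) ^ n ≤ |x| ∧ |x| ≤ 2 ^ (n + 1) → r n * j ≤ x ∧ x ≤ r n * (j + 1) → (n, j) ∈ T := by
    intro n j hn hnα x hxY hxA hxc
    rw [hTmem]
    exact ⟨index_bounds hδ1.le hK hn hnα hxA hxc, hnα, x, ⟨hxY, hxA⟩, hxc⟩
  -- the weight
  set c : ℕ × ℤ → ℝ := fun p => r p.1 * (p.2 + 1 / 2) with hcdef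
  set Ω : ℝ → ℝ := fun ξ => 2 * (1 + ξ ^ 2) ^ (1 / 4 : ℝ) +
    10 * ∑ p ∈ T, r p.1 * χ ((ξ - c p) / r p.1) with hΩdef
  have hsum0 : ∀ ξ, 0 ≤ ∑ p ∈ T, r p.1 * χ ((ξ - c p) / r p.1) := fun ξ =>
    Finset.sum_nonneg fun p hp => scaledCutoff_nonneg hχ0 (hrpos p hp) _ _
  have hΩlow : ∀ ξ, (1 + ξ ^ 2) ^ (1 / 4 : ℝ) ≤ Ω ξ := fun ξ => by
    have := one_le_bracket ξ; have := hsum0 ξ; simp only [hΩdef]; linarith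
  -- derivative
  have hderiv : ∀ ξ, HasDerivAt Ω (2 * (2 * ξ * (1 / 4) * (1 + ξ ^ 2) ^ (1 / 4 - 1 : ℝ)) +
      10 * ∑ p ∈ T, deriv χ ((ξ - c p) / r p.1)) ξ := fun ξ =>
    ((hasDerivAt_bracket ξ).const_mul 2).add
      ((hasDerivAt_sum_scaledCutoff hχd T c (fun p => r p.1) hrne ξ).const_mul 10)
  have hderiv_bound : ∀ ξ, |deriv Ω ξ| ≤ Kd := by
    intro ξ
    rw [(hderiv ξ).deriv]
    have h1 := abs_deriv_bracket_le ξ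
    have h2 := abs_sum_deriv_scaledCutoff_le hχzero hB T c (fun p => r p.1) hrpos ξ
    have h3 : ((T.filter fun p => |ξ - c p| ≤ r p.1).card : ℝ) ≤ 51 := by
      exact_mod_cast card_near_le hr16 hrpos hT1 hTmeet ξ
    have e1 : |2 * (2 * ξ * (1 / 4) * (1 + ξ ^ 2) ^ (1 / 4 - 1 : ℝ))| ≤ 2 * (1 / 2) := by
      rw [abs_mul, abs_two]; exact mul_le_mul_of_nonneg_left h1 zero_le_two
    have e2 : |10 * ∑ p ∈ T, deriv χ ((ξ - c p) / r p.1)| ≤ 10 * (B * 51) := by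
      rw [abs_mul, abs_of_pos (by norm_num : (0 : ℝ) < 10)]
      exact mul_le_mul_of_nonneg_left (h2.trans (mul_le_mul_of_nonneg_left h3 hB0)) (by norm_num)
    calc |2 * (2 * ξ * (1 / 4) * (1 + ξ ^ 2) ^ (1 / 4 - 1 : ℝ)) +
          10 * ∑ p ∈ T, deriv χ ((ξ - c p) / r p.1)|
        ≤ |2 * (2 * ξ * (1 / 4) * (1 + ξ ^ 2) ^ (1 / 4 - 1 : ℝ))| +
          |10 * ∑ p ∈ T, deriv χ ((ξ - c p) / r p.1)| := abs_add_le _ _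
      _ ≤ 2 * (1 / 2) + 10 * (B * 51) := add_le_add e1 e2
      _ = Kd := by simp only [hKd]; ring
  -- smoothness
  have hΩC : ContDiff ℝ 1 Ω := by
    simp only [hΩdef]
    refine (contDiff_const.mul contDiff_bracket).add (contDiff_const.mul (ContDiff.sum fun p hp => ?_))
    exact contDiff_const.mul (hχC.comp ((contDiff_id.sub contDiff_const).div_const _))
  -- Poisson integral
  have hterm : ∀ p ∈ T, Integrable (fun ξ => r p.1 * χ ((ξ - c p) / r p.1) / (1 + ξ ^ 2)) ∧
      ∫ ξ, r p.1 * χ ((ξ - c p) / r p.1) / (1 + ξ ^ 2) ≤ 2 * (r p.1) ^ 2 * ((4 : ℝ) ^ 16 / 4 ^ p.1) := by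
    intro p hp
    obtain ⟨x, hxA, hxc⟩ := hTmeet p hp
    exact integral_scaledCutoff_div_le hχc hχ0 hχ1 hχzero (hrpos p hp) (c p) (by positivity)
      fun ξ hξ => inv_one_add_sq_le hr16 hxA hxc hξ
  have hΩdiv : ∀ ξ, Ω ξ / (1 + ξ ^ 2) = 2 * ((1 + ξ ^ 2) ^ (1 / 4 : ℝ) / (1 + ξ ^ 2)) +
      10 * ∑ p ∈ T, r p.1 * χ ((ξ - c p) / r p.1) / (1 + ξ ^ 2) := by
    intro ξ
    simp only [hΩdef]
    rw [add_div, mul_div_assoc, mul_div_assoc, Finset.sum_div]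
  have hΩint : Integrable (fun ξ => Ω ξ / (1 + ξ ^ 2)) := by
    simp_rw [hΩdiv]
    exact (integrable_bracket_div.const_mul 2).add
      ((integrable_finsetSum T fun p hp => (hterm p hp).1).const_mul 10)
  have hfibre_sum : ∑ p ∈ T, 2 * (r p.1) ^ 2 * ((4 : ℝ) ^ 16 / 4 ^ p.1) ≤ 24 * 4 ^ 16 * C_R ^ 2 * S := by
    rw [← Finset.sum_fiberwise_of_maps_to (g := Prod.fst) (t := T.image Prod.fst)
      (fun p hp => Finset.mem_image_of_mem Prod.fst hp)]
    have hinner : ∀ n ∈ T.image Prod.fst,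
        ∑ p ∈ T.filter (fun p => p.1 = n), 2 * (r p.1) ^ 2 * ((4 : ℝ) ^ 16 / 4 ^ p.1) ≤
          24 * 4 ^ 16 * C_R ^ 2 * (n : ℝ) ^ (-s) := by
      intro n hn
      have hn1 : 1 ≤ n := by
        obtain ⟨p, hp, rfl⟩ := Finset.mem_image.1 hn; exact hT1 p hp
      have hn0 : (0 : ℝ) < n := by exact_mod_cast hn1
      have hval : ∀ p ∈ T.filter (fun p => p.1 = n),
          2 * (r p.1) ^ 2 * ((4 : ℝ) ^ 16 / 4 ^ p.1) = 2 * 4 ^ 16 * (n : ℝ) ^ (-(1 + δ)) := by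
        intro p hp
        rw [(Finset.mem_filter.1 hp).2]
        simp only [hrdef]
        rw [scale_sq hn1]
        have : (0 : ℝ) < 4 ^ n := by positivity
        field_simp
      rw [Finset.sum_congr rfl hval, Finset.sum_const, nsmul_eq_mul]
      have hcard := card_fibre_le hY hC hδ0.le hδ1.le T hT n
      have hpow : (n : ℝ) ^ (δ * (1 + δ) / 2) * (n : ℝ) ^ (-(1 + δ)) = (n : ℝ) ^ (-s) := by
        rw [← Real.rpow_add hn0]; congr 1; simp only [hs]; ring
      have hnn : 0 ≤ 2 * 4 ^ 16 * (n : ℝ) ^ (-(1 + δ)) := by positivity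
      calc ((T.filter fun p => p.1 = n).card : ℝ) * (2 * 4 ^ 16 * (n : ℝ) ^ (-(1 + δ)))
          ≤ (12 * C_R ^ 2 * (n : ℝ) ^ (δ * (1 + δ) / 2)) * (2 * 4 ^ 16 * (n : ℝ) ^ (-(1 + δ))) :=
            mul_le_mul_of_nonneg_right hcard hnn
        _ = 24 * 4 ^ 16 * C_R ^ 2 * ((n : ℝ) ^ (δ * (1 + δ) / 2) * (n : ℝ) ^ (-(1 + δ))) := by ring
        _ = 24 * 4 ^ 16 * C_R ^ 2 * (n : ℝ) ^ (-s) := by rw [hpow]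
    calc ∑ n ∈ T.image Prod.fst, ∑ p ∈ T.filter (fun p => p.1 = n), 2 * (r p.1) ^ 2 * ((4 : ℝ) ^ 16 / 4 ^ p.1)
        ≤ ∑ n ∈ T.image Prod.fst, 24 * 4 ^ 16 * C_R ^ 2 * (n : ℝ) ^ (-s) := Finset.sum_le_sum hinner
      _ = 24 * 4 ^ 16 * C_R ^ 2 * ∑ n ∈ T.image Prod.fst, (n : ℝ) ^ (-s) := by rw [Finset.mul_sum]
      _ ≤ 24 * 4 ^ 16 * C_R ^ 2 * S := by
          gcongr
          exact hsum.sum_le_tsum _ fun n _ => Real.rpow_nonneg (Nat.cast_nonneg n) _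
  have hΩint_le : ∫ ξ, Ω ξ / (1 + ξ ^ 2) ≤ Ci := by
    simp_rw [hΩdiv]
    rw [integral_add (integrable_bracket_div.const_mul 2)
      ((integrable_finsetSum T fun p hp => (hterm p hp).1).const_mul 10),
      integral_const_mul, integral_const_mul, integral_finsetSum T fun p hp => (hterm p hp).1]
    have h1 : ∑ p ∈ T, ∫ ξ, r p.1 * χ ((ξ - c p) / r p.1) / (1 + ξ ^ 2) ≤ 24 * 4 ^ 16 * C_R ^ 2 * S :=
      (Finset.sum_le_sum fun p hp => (hterm p hp).2).trans hfibre_sum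
    simp only [hCi]
    linarith
  -- decay on `Y`
  have hY_bound : ∀ ξ ∈ Y, Real.log (10 + |ξ|) ^ (-(1 + δ) / 2) * |ξ| ≤ Ω ξ := by
    intro ξ hξY
    by_cases h2 : |ξ| ≤ 2
    · have := theta_mul_abs_le_two (δ := δ) (by linarith) h2
      have := hΩlow ξ; have := one_le_bracket ξ; have := hsum0 ξ
      simp only [hΩdef] at *; linarith
    · have h2' : 2 < |ξ| := lt_of_not_ge h2
      obtain ⟨n, hn1, hn2⟩ := exists_nat_pow_near (x := |ξ|) (y := (2 : ℝ)) (by linarith) one_lt_two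
      have hn : 1 ≤ n := by
        rcases Nat.eq_zero_or_pos n with h | h
        · rw [h] at hn2; norm_num at hn2; linarith
        · exact h
      have hξα : |ξ| ≤ α₁ := abs_le.2 (hYsub hξY)
      have hnα : (2 : ℝ) ^ n ≤ α₁ := hn1.trans hξα
      have hrn : 0 < r n := scale_pos hδ1.le hn
      set j : ℤ := ⌊ξ / r n⌋ with hjdef
      have hj1 : (j : ℝ) ≤ ξ / r n := Int.floor_le _
      have hj2 : ξ / r n < j + 1 := Int.lt_floor_add_one _
      have hxc : r n * j ≤ ξ ∧ ξ ≤ r n * (j + 1) := by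
        rw [le_div_iff₀ hrn] at hj1
        rw [div_lt_iff₀ hrn] at hj2
        constructor <;> nlinarith
      have hxA : (2 : ℝ) ^ n ≤ |ξ| ∧ |ξ| ≤ 2 ^ (n + 1) := ⟨hn1, hn2.le⟩
      have hmem : (n, j) ∈ T := hTcomplete n j hn hnα ξ hξY hxA hxc
      have hnear : |ξ - c (n, j)| ≤ r n / 2 := by
        simp only [hcdef]
        rw [abs_le]; constructor <;> nlinarith [hxc.1, hxc.2]
      have hone : r n * χ ((ξ - c (n, j)) / r n) = r n := scaledCutoff_eq_self hχone hrn hnear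
      have hsingle : r n ≤ ∑ p ∈ T, r p.1 * χ ((ξ - c p) / r p.1) := by
        have := Finset.single_le_sum (f := fun p : ℕ × ℤ => r p.1 * χ ((ξ - c p) / r p.1))
          (fun p hp => scaledCutoff_nonneg hχ0 (hrpos p hp) _ _) hmem
        simpa only [hone] using this
      have hθ := theta_mul_abs_le_scale hδ0.le hδ1.le hn hn1 hn2.le
      have := one_le_bracket ξ
      simp only [hΩdef, hrdef] at hsingle ⊢
      linarith
  refine ⟨Ω, hΩC, hΩlow, fun ξ => (hderiv_bound ξ).trans (by linarith), hΩint,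
    hΩint_le.trans (by linarith), hY_bound⟩

open AdaptedWeight in
/-- **The adapted weight of BD18 Lemma 3.1** (J. Bourgain, S. Dyatlov, *Spectral gaps without the
pressure condition*, Ann. of Math. 187 (2018), §3.1, the weight `ω` defined in the proof of
Lemma 3.1 and the two displayed estimates following its definition). Let `0 < δ < 1`, `C_R ≥ 1`.
There is `C₀ > 0` depending only on `δ, C_R` such that for every `α₁` and every
`Y ⊂ [-α₁, α₁]` `δ`-regular with constant `C_R` on scales `2` to `α₁` there is a weight
`ω ∈ C¹(ℝ; (0, 1])` with `sup |∂_ξ log ω| ≤ C₀`, `∫ |log ω(ξ)|/(1+ξ²) dξ ≤ C₀` (the two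
hypotheses of the quantitative Beurling–Malliavin lemma, BD18 Lemma 2.11),
`ω(ξ) ≤ exp(-⟨ξ⟩^{1/2})` for all `ξ ∈ ℝ` and `ω(ξ) ≤ exp(-θ(ξ)|ξ|)` for `ξ ∈ Y`, where
`θ(ξ) = log(10+|ξ|)^{-(1+δ)/2}` and `⟨ξ⟩ = (1+ξ²)^{1/2}` ("we have verified that the weight `ω`
satisfies (the hypotheses of Lemma 2.11)", proof of Lemma 3.1). Feeding `ω` to BD18 Lemma 2.11
(with `c₀ := c₁/10`) is the remainder of that proof; Lemma 2.11 (Beurling–Malliavin) is not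
formalized here. [cite: BourgainDyatlov2018, §3.1, proof of Lemma 3.1] -/
theorem exists_adaptedWeight (hδ0 : 0 < δ) (hδ1 : δ < 1) (hC : 1 ≤ C_R) :
    ∃ C₀ : ℝ, 0 < C₀ ∧ ∀ (α₁ : ℝ) (Y : Set ℝ), Y ⊆ Icc (-α₁) α₁ → IsRegularSet Y δ C_R 2 α₁ →
      ∃ ω : ℝ → ℝ, ContDiff ℝ 1 ω ∧ (∀ ξ, 0 < ω ξ) ∧ (∀ ξ, ω ξ ≤ 1) ∧
        (∀ ξ, |deriv (fun η => Real.log (ω η)) ξ| ≤ C₀) ∧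
        Integrable (fun ξ => |Real.log (ω ξ)| / (1 + ξ ^ 2)) ∧
        (∫ ξ, |Real.log (ω ξ)| / (1 + ξ ^ 2) ≤ C₀) ∧
        (∀ ξ, ω ξ ≤ Real.exp (-(1 + ξ ^ 2) ^ (1 / 4 : ℝ))) ∧
        (∀ ξ ∈ Y, ω ξ ≤ Real.exp (-(Real.log (10 + |ξ|) ^ (-(1 + δ) / 2) * |ξ|))) := by
  obtain ⟨C₀, hC₀, h⟩ := exists_adaptedLogWeight hδ0 hδ1 hC
  refine ⟨C₀, hC₀, fun α₁ Y hYsub hY => ?_⟩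
  obtain ⟨Ω, hΩC, hΩlow, hΩd, hΩi, hΩile, hΩY⟩ := h α₁ Y hYsub hY
  have hΩpos : ∀ ξ, 0 < Ω ξ := fun ξ => (zero_lt_one.trans_le (one_le_bracket ξ)).trans_le (hΩlow ξ)
  have hlog : (fun η => Real.log (Real.exp (-Ω η))) = fun η => -Ω η := funext fun η => Real.log_exp _
  have habs : ∀ ξ, |Real.log (Real.exp (-Ω ξ))| = Ω ξ := fun ξ => by
    rw [Real.log_exp, abs_neg, abs_of_pos (hΩpos ξ)]
  refine ⟨fun ξ => Real.exp (-Ω ξ), hΩC.neg.exp, fun ξ => Real.exp_pos _, fun ξ => ?_, fun ξ => ?_,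
    ?_, ?_, fun ξ => ?_, fun ξ hξ => ?_⟩
  · rw [Real.exp_le_one_iff]; linarith [hΩpos ξ]
  · rw [hlog, show (fun η => -Ω η) = -Ω from rfl, deriv.neg, abs_neg]; exact hΩd ξ
  · simp_rw [habs]; exact hΩi
  · simp_rw [habs]; exact hΩile
  · exact Real.exp_le_exp.2 (neg_le_neg (hΩlow ξ))
  · exact Real.exp_le_exp.2 (neg_le_neg (hΩY ξ hξ))

end Main

end Literature.Analysis.Fourier
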